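import Summits.QuantumFields.BalabanUV.Beta.FP.TowerQN1RowJet
import Summits.QuantumFields.BalabanUV.Beta.FP.TorusNBindingOfJunctionsGauge

/-!
# `BalabanUV.Beta.FP.TowerHN2RowJet` — road «FP», binder row D1, ROUTE T (β1), (E4d²) PART 1: **THE END WRAPPER's SECOND-ORDER H-SIDE JET `H′₂f`, SYMMETRISED, IS THE
# WILSON BI-JET ALONG THE TWO GAUGE-COMPLETED DIRECTIONS PLUS ONE DISPLAYED REMAINDER** — the H-side twin of #6 `TowerQN2RowJet`: v5's conjugated second H-jet
# `hH′₂f` (`FP/StepRecursionFeedNestedNamedD` l.182), symmetrised in the two directions (as `hHN₂` reads it), is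
# `H₂ˢ(v,v′) + c•([E, H₁f v′] + [E′, H₁f v]) + c²•[E,[E′,H₀]]` (`E := diagonal (lv v ∘ pr)`) — at order 2 the conjugation hits the WHOLE first jet `H₁f`, Wilson
# sector AND Λ-words.  Writing `H₁f v = (−2c)•𝒲₁(hv v) + Λ₁ v` (the shape of `hH₁f`) and NAMING the remainder of the symmetrised second jet off the Wilson bi-sector,
# `½•(H₂f v v′ + H₂f v′ v) = (−2c)²•𝒲₂(hv v, hv v′) + Λ₂ v v′`, the Wilson sector closes EXACTLY AS ON THE 𝔔 SIDE (SPEC-54 §1): the order-1 pure-gauge law (J-X)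
# `𝒲₁(Dλ) = ½(H₀E_λ − E_λH₀)` (leaf-05, in tree) and THE ORDER-2 PURE-GAUGE ROW **(J-X₂) `𝒲₂(h, Dλ) = ½(𝒲₁(h)E_λ − E_λ𝒲₁(h))`** give
# `½•(H′₂f v v′ + H′₂f v′ v) = (−2c)²•𝒲₂(hv v + D(lv v), hv v′ + D(lv v′)) + R₂(v,v′)`, `R₂(v,v′) := Λ₂ v v′ + c•([E,Λ₁ v′] + [E′,Λ₁ v])`, and along two pinned
# directions ((J-W″) twice, the pin `(−2c)·r = cE`) the Wilson sector is `cE² •` the bi-table along the two torus ℋ-columns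

WHY (journal l.67846 A-5, l.67851 an2 g69 A-1, l.67861 an2 INTENT-3 PART 23, l.67863 road A-1 ∕ Q-FP-45-1; `HOME/b2b-balaban-beta-d1-p3/g42/SPEC-54.md` §1 ∕ §6).  v5 displays NO
closed form for `H₂f` (free bilinear family, rows `hH₂l hH₂r hH₂t a2`); this file assumes NONE — `Λ₂` is a name for `½•(H₂f v v′ + H₂f v′ v) − (−2c)²•𝒲₂(hv v, hv v′)`.  The
coefficient `(−2c)²` of the Wilson bi-sector is FORCED by the cancellation (`s²∕2 + c·s = 0` at `s = −2c`: `hH₁f`'s `−2c`, `X = −c•E`, the `½`-normalised rows); the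
gauge–gauge block closes by Jacobi at `[E, E′] = 0`.  The row's PART 23 (`Beta/NVertexEvenCarrierTorus.perF_dper_wound_WN_evenHalf_inl_inl_eq_sum`) reads the RIGHT side of
`hHN₂` as `cE₂·`(symmetrised Wilson bi-vertex over the wound even bi-stencil `Ŵ₂ᵉ`) + two mixed words; the junction (`FP/TowerHN2Row`, next) is then ONE scalar lock row
`hcE₂ : cE² = cE₂` at `T̂₂ := ½(Ŵ₂ᵉ + Ŵ₂ᵉ∘swap)`, the displayed row (J-X₂) for that table, and ONE displayed identity (J-Λ₂) `R₂ = the mixed words`.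
WHAT ([folklore] `Matrix` algebra + bookkeeping BY NAME; no `def`, no `def … : Prop`, nothing cited, 0 sorry): §1 **`Hprime2_symm_eq_biW_along_sums_of_pureGauge`** — pure
algebra over an abstract first Wilson jet `𝒲₁` and bi-jet `𝒲₂` (additive in each weight, symmetric) with (J-X), (J-X₂) as hypotheses, v5's `hH′₂f` VERBATIM (`Mc B ↦ M`,
`c n ↦ c`, `lv n B ↦ lv`, …); §2 **`Hprime2_symm_eq_biW_along_sums`** — the Wilson instantiation `𝒲₁ h := Σ_b h_b • Ŵ_b|ff` (`Ŵ_b := perF T (dper T (wilsonA 3 b.2 ↑b.1))`,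
`hH₁f`'s table), `𝒲₂ h h′ := Σ_b Σ_{b′} (h_b·h′_{b′}) • T̂₂ b b′` over a DISPLAYED symmetric torus bi-table `T̂₂` with (J-X₂) DISPLAYED (`hX₂`) and (J-X) DISCHARGED at the wrapper's
form pin `hH₀` (leaf-02 `perF_bhKStepSh_Dsh_ff_eq_perF_bhKStepAt` + g39 `torus_form_pureGauge_fun_of_box`); §3 **`Hprime2_symm_eq_sq_smul_bivertex_cols_add_rem`** — along
`(r•e_a, r•e_{a′})` with (J-W″) at `r := 1` (`hJW`, #3 `direction_add_exact_eq_smul_col`) and the pin `hr : (−2c)·r = Pn.cE (n+2)`: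
`½•(H′₂f … + sym) = (Pn.cE (n+2))² • Σ_b Σ_{b′} (colN̂_a b · colN̂_{a′} b′) • T̂₂ b b′ + R₂(r•e_a, r•e_{a′})`.
WHAT THIS IS NOT: not a display of `H₂f` (v6's business; `Λ₂` is a name); not (J-X₂)'s inhabitation (for an1's table it is the shape of the row's `CombWilsonT2Periodised(K2)
.torus_H2_pureGauge_fst_fun ∕ _snd_fun`; for the FREE pin `Pn.T (n+2)` a junction condition); not the junction with PART 23 (`TowerHN2Row`); not `a2`; nothing of Bałaban's
asserted, valued or discharged; 0 estimates; 0∕4 row-D1 binders (hW, hR, D1Tel, D1Rep); ROOT M‴ p325680 ∕ P5c ∕ D6 untouched; NOT (C1), NOT (T-ID), NOT D1, NEVER «G-an2-4 closed»,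
NOT BetaPertH, NOT continuum, NOT Clay.

HONEST DEPENDENCY (page 1, mandatory): continuum YM on T⁴ ⇐ BetaPertH ∧ nine spine estimates (0/9 proved); BetaPertH ⇐ (D1) ∧ (D4) ∧ CAP+tail;
G-an2-4 gates asym, D1 and NE2/3/4.  HONEST FRAMING (cell contract, verbatim): «discharging `BetaPertH` makes Bałaban's UV stability UNCONDITIONAL —
a real constructive-QFT result; it is NOT the continuum limit and NOT the Clay problem.»  ABSOLUTE RULE (cell charter, verbatim): «No internally-minted
statement may enter as a cited fact. Every hypothesis is either kernel-proved in this package or a verbatim quotation of a PUBLISHED theorem with page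
reference. The manuscript(s) under audit are NOT citable for their own disputed steps — they are the thing under adjudication; programme-internal
(2001/route/tribunal) claims are never citable.»  Road «FP» OWNER, b2b-balaban-beta-d1-p3 gen 45, 2026-08-27.  No existing file touched.
-/

noncomputable section

open scoped BigOperators

namespace Summit.QuantumFields.BalabanUV.Beta.FP.TowerHN2RowJet

open Finset Matrix
open Literature.MathematicalPhysics.QuantumFieldTheory
open Literature.MathematicalPhysics.QuantumFieldTheory.Balaban1983to89
open Literature.MathematicalPhysics.QuantumFieldTheory.Balaban1983to89.Beta
open B5Prop11Plancherel (fine)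
open B6Lemma24Torus (pbox)
open AffineAveraging (Site box toSite)
open AveragingContoursRooted (ctr ctrOff)
open OneStepResolventKernel (Fib)
open StepJetData (wilsonA)
open Summit.QuantumFields.BalabanUV.Beta.BorderedHessian (bhKStepAt)
open Summit.QuantumFields.BalabanUV.Beta.SymShiftedSpread (bhKStepSh)
open Summit.QuantumFields.BalabanUV.Beta.DshAn1 (Dsh)
open Summit.QuantumFields.BalabanUV.Beta.CompositeOneShotJetData (Roots Pins AN)
open Summit.QuantumFields.BalabanUV.Beta.FP.KernelPeriodisationFib (Idx perF)
open Summit.QuantumFields.BalabanUV.Beta.FP.KernelPeriodisationFibLoc (dper)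
open Summit.QuantumFields.BalabanUV.Beta.FP.TorusGaugeCovariance (tgrad)
open Summit.QuantumFields.BalabanUV.Beta.FP.TorusGaugeCovariancePairing (wrapPt)
open Summit.QuantumFields.BalabanUV.Beta.FP.TorusCompositeObjects (towerTorus)
open Summit.QuantumFields.BalabanUV.Beta.FP.TowerQN1RowJet (direction_add_exact_eq_smul_col)
open Summit.QuantumFields.BalabanUV.Beta.FP.TorusNBindingOfJunctionsGauge (torus_form_pureGauge_fun_of_box)
open Summit.QuantumFields.BalabanUV.Beta.FP.NestedStepLawTorusTransportedRowsGradedSym (perF_bhKStepSh_Dsh_ff_eq_perF_bhKStepAt)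

variable {Lc : ℕ} [NeZero Lc] (M : Fin (3 + 1) → ℕ) [∀ μ, NeZero (M μ)] (n : ℕ) (c : ℝ)

/-! ## §1 The order-2 H-side gauge step as pure algebra -/

section Gauge

variable {κ : Type*}
  (hv : (κ → ℝ) → (↥(pbox (towerTorus Lc (fine Lc M) (n + 1))) × Fin (3 + 1) → ℝ))
  (lv : (κ → ℝ) → (↥(pbox (towerTorus Lc (fine Lc M) (n + 1))) → ℝ))
  (H₀ : Matrix (↥(pbox (towerTorus Lc (fine Lc M) (n + 1))) × Fin (3 + 1)) (↥(pbox (towerTorus Lc (fine Lc M) (n + 1))) × Fin (3 + 1)) ℝ)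
  -- an abstract first Wilson jet `𝒲₁` (weight ↦ matrix) and the REST `Λ₁` of v5's first H-jet: `H₁f v = (−2c)•𝒲₁(hv v) + Λ₁ v` (the shape of `hH₁f`)
  (𝒲₁ : (↥(pbox (towerTorus Lc (fine Lc M) (n + 1))) × Fin (3 + 1) → ℝ) → Matrix (↥(pbox (towerTorus Lc (fine Lc M) (n + 1))) × Fin (3 + 1)) (↥(pbox (towerTorus Lc (fine Lc M) (n + 1))) × Fin (3 + 1)) ℝ)
  (Λ₁ : (κ → ℝ) → Matrix (↥(pbox (towerTorus Lc (fine Lc M) (n + 1))) × Fin (3 + 1)) (↥(pbox (towerTorus Lc (fine Lc M) (n + 1))) × Fin (3 + 1)) ℝ)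
  (H₁f : (κ → ℝ) → Matrix (↥(pbox (towerTorus Lc (fine Lc M) (n + 1))) × Fin (3 + 1)) (↥(pbox (towerTorus Lc (fine Lc M) (n + 1))) × Fin (3 + 1)) ℝ)
  (hH₁' : ∀ v, H₁f v = (-2 * c) • 𝒲₁ (hv v) + Λ₁ v)
  -- an abstract Wilson bi-jet `𝒲₂` and the NAME `Λ₂` of the remainder of the symmetrised second H-jet off its `(−2c)²`-weighted Wilson bi-sector (no display of `H₂f` assumed)
  (𝒲₂ : (↥(pbox (towerTorus Lc (fine Lc M) (n + 1))) × Fin (3 + 1) → ℝ) → (↥(pbox (towerTorus Lc (fine Lc M) (n + 1))) × Fin (3 + 1) → ℝ) → Matrix (↥(pbox (towerTorus Lc (fine Lc M) (n + 1))) × Fin (3 + 1)) (↥(pbox (towerTorus Lc (fine Lc M) (n + 1))) × Fin (3 + 1)) ℝ)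
  (Λ₂ : (κ → ℝ) → (κ → ℝ) → Matrix (↥(pbox (towerTorus Lc (fine Lc M) (n + 1))) × Fin (3 + 1)) (↥(pbox (towerTorus Lc (fine Lc M) (n + 1))) × Fin (3 + 1)) ℝ)
  (H₂f : (κ → ℝ) → (κ → ℝ) → Matrix (↥(pbox (towerTorus Lc (fine Lc M) (n + 1))) × Fin (3 + 1)) (↥(pbox (towerTorus Lc (fine Lc M) (n + 1))) × Fin (3 + 1)) ℝ)
  (hH₂' : ∀ v v', (1 / 2 : ℝ) • (H₂f v v' + H₂f v' v) = (-2 * c) ^ 2 • 𝒲₂ (hv v) (hv v') + Λ₂ v v')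
  -- v5's SECOND-ORDER H-SIDE CONJUGATION `hH'₂f` VERBATIM (`FP/StepRecursionFeedNestedNamedD` l.182; `X v := −(c • diagonal (lv v ∘ fst))` spelled out as there)
  (H'₂f : (κ → ℝ) → (κ → ℝ) → Matrix (↥(pbox (towerTorus Lc (fine Lc M) (n + 1))) × Fin (3 + 1)) (↥(pbox (towerTorus Lc (fine Lc M) (n + 1))) × Fin (3 + 1)) ℝ)
  (hH'₂f : ∀ v v', H'₂f v v' = ((-(c • Matrix.diagonal (fun b : (↥(pbox (towerTorus Lc (fine Lc M) (n + 1))) × Fin (3 + 1)) => lv v b.1))) * (-(c • Matrix.diagonal (fun b : (↥(pbox (towerTorus Lc (fine Lc M) (n + 1))) × Fin (3 + 1)) => lv v' b.1))))ᵀ * H₀ + (-((-(c • Matrix.diagonal (fun b : (↥(pbox (towerTorus Lc (fine Lc M) (n + 1))) × Fin (3 + 1)) => lv v b.1)))ᵀ * H₁f v') + -((-(c • Matrix.diagonal (fun b : (↥(pbox (towerTorus Lc (fine Lc M) (n + 1))) × Fin (3 + 1)) => lv v b.1)))ᵀ * H₀ * (-(c • Matrix.diagonal (fun b : (↥(pbox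 (towerTorus Lc (fine Lc M) (n + 1))) × Fin (3 + 1)) => lv v' b.1)))))
    + ((-((-(c • Matrix.diagonal (fun b : (↥(pbox (towerTorus Lc (fine Lc M) (n + 1))) × Fin (3 + 1)) => lv v b.1)))ᵀ * H₁f v') + -((-(c • Matrix.diagonal (fun b : (↥(pbox (towerTorus Lc (fine Lc M) (n + 1))) × Fin (3 + 1)) => lv v b.1)))ᵀ * H₀ * (-(c • Matrix.diagonal (fun b : (↥(pbox (towerTorus Lc (fine Lc M) (n + 1))) × Fin (3 + 1)) => lv v' b.1))))) + (H₂f v v' + H₁f v * (-(c • Matrix.diagonal (fun b : (↥(pbox (towerTorus Lc (fine Lc M) (n + 1))) × Fin (3 + 1)) => lv v' b.1))) + (H₁f v * (-(c • Matrix.diagonal (fun b : (↥(pbox (towerTorus Lc (fine Lc M) (n + 1))) × Fin (3 + 1)) => lv v' b.1))) + H₀ * ((-(c • Matrix.diagonal (fun b : (↥(pbox (towerTorus Lc (fine Lc M) (n + 1))) × Fin (3 + 1)) => lv v b.1))) * (-(c • Matrix.diagonal (fun b : (↥(pbox (towerTorus Lc (fine Lc M) (n + 1))) × Fin (3 + 1))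 => lv v' b.1))))))))

omit [NeZero Lc] [∀ μ, NeZero (M μ)] in
include hH₁' hH₂' hH'₂f in
/-- [folklore] **`Hprime2_symm_eq_biW_along_sums_of_pureGauge` — THE ORDER-2 H-SIDE GAUGE STEP AS PURE ALGEBRA**: GIVEN an abstract first Wilson jet `𝒲₁` obeying the order-1
pure-gauge law (J-X) `hPG₁ : 𝒲₁ (tgrad·λ) = ½•(H₀·E_λ − E_λ·H₀)`, and an abstract bi-jet `𝒲₂`, additive in both weights (`hBaddl ∕ hBaddr`), symmetric (`hBcomm`) and obeying THE
ORDER-2 PURE-GAUGE ROW **(J-X₂) `hPG₂ : 𝒲₂ h (tgrad·λ) = ½•(𝒲₁ h·E_λ − E_λ·𝒲₁ h)`** (`E_λ = diagonal (λ ∘ pr)`), v5's conjugated second H-jet, SYMMETRISED, is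
`(−2c)² • 𝒲₂ (hv v + tgrad·lv v) (hv v′ + tgrad·lv v′)` PLUS the displayed remainder `Λ₂ v v′ + c•([E_{lv v}, Λ₁ v′] + [E_{lv v′}, Λ₁ v])`: remove the diagonal transposes,
expand the right side by bi-additivity into the four blocks `𝒲₂ h h′`, `𝒲₂ h (Dλ′)`, `𝒲₂ (Dλ) h′`, `𝒲₂ (Dλ) (Dλ′)` — the last is `½•(𝒲₁(Dλ)·E′ − E′·𝒲₁(Dλ))` by `hPG₂` and then
`hPG₁`, so the gauge–gauge block `E′EH₀ − EH₀E′ − E′H₀E + H₀EE′` of `hH′₂f` needs NO separate law (Jacobi at `[E,E′] = 0`: the diagonal generators commute); the cross terms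
`c•[E, (−2c)•𝒲₁(hv v′)]` are `(−2c)²•𝒲₂ (hv v) (Dλ′)`'s partner EXACTLY because `(−2c)²∕2 + c·(−2c) = 0`. -/
theorem Hprime2_symm_eq_biW_along_sums_of_pureGauge
    (hPG₁ : ∀ lam : ↥(pbox (towerTorus Lc (fine Lc M) (n + 1))) → ℝ,
      𝒲₁ (fun b : ↥(pbox (towerTorus Lc (fine Lc M) (n + 1))) × Fin (3 + 1) =>
            ∑ s : ↥(pbox (towerTorus Lc (fine Lc M) (n + 1))), tgrad (towerTorus Lc (fine Lc M) (n + 1)) (b.1, Sum.inl b.2) s * lam s)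
        = (1 / 2 : ℝ) • (H₀ * Matrix.diagonal (fun b : ↥(pbox (towerTorus Lc (fine Lc M) (n + 1))) × Fin (3 + 1) => lam b.1)
          - Matrix.diagonal (fun b : ↥(pbox (towerTorus Lc (fine Lc M) (n + 1))) × Fin (3 + 1) => lam b.1) * H₀))
    (hPG₂ : ∀ (h : ↥(pbox (towerTorus Lc (fine Lc M) (n + 1))) × Fin (3 + 1) → ℝ) (lam : ↥(pbox (towerTorus Lc (fine Lc M) (n + 1))) → ℝ),
      𝒲₂ h (fun b : ↥(pbox (towerTorus Lc (fine Lc M) (n + 1))) × Fin (3 + 1) =>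
            ∑ s : ↥(pbox (towerTorus Lc (fine Lc M) (n + 1))), tgrad (towerTorus Lc (fine Lc M) (n + 1)) (b.1, Sum.inl b.2) s * lam s)
        = (1 / 2 : ℝ) • (𝒲₁ h * Matrix.diagonal (fun b : ↥(pbox (towerTorus Lc (fine Lc M) (n + 1))) × Fin (3 + 1) => lam b.1)
          - Matrix.diagonal (fun b : ↥(pbox (towerTorus Lc (fine Lc M) (n + 1))) × Fin (3 + 1) => lam b.1) * 𝒲₁ h))
    (hBaddl : ∀ h₁ h₂ h' : ↥(pbox (towerTorus Lc (fine Lc M) (n + 1))) × Fin (3 + 1) → ℝ, 𝒲₂ (h₁ + h₂) h' = 𝒲₂ h₁ h' + 𝒲₂ h₂ h')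
    (hBaddr : ∀ h h₁ h₂ : ↥(pbox (towerTorus Lc (fine Lc M) (n + 1))) × Fin (3 + 1) → ℝ, 𝒲₂ h (h₁ + h₂) = 𝒲₂ h h₁ + 𝒲₂ h h₂)
    (hBcomm : ∀ h h' : ↥(pbox (towerTorus Lc (fine Lc M) (n + 1))) × Fin (3 + 1) → ℝ, 𝒲₂ h h' = 𝒲₂ h' h)
    (v v' : κ → ℝ) :
    (1 / 2 : ℝ) • (H'₂f v v' + H'₂f v' v)
      = (-2 * c) ^ 2 • 𝒲₂ (hv v + (fun b : ↥(pbox (towerTorus Lc (fine Lc M) (n + 1))) × Fin (3 + 1) =>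
            ∑ s : ↥(pbox (towerTorus Lc (fine Lc M) (n + 1))), tgrad (towerTorus Lc (fine Lc M) (n + 1)) (b.1, Sum.inl b.2) s * lv v s))
          (hv v' + (fun b : ↥(pbox (towerTorus Lc (fine Lc M) (n + 1))) × Fin (3 + 1) =>
            ∑ s : ↥(pbox (towerTorus Lc (fine Lc M) (n + 1))), tgrad (towerTorus Lc (fine Lc M) (n + 1)) (b.1, Sum.inl b.2) s * lv v' s))
        + (Λ₂ v v' + c • (Matrix.diagonal (fun b : ↥(pbox (towerTorus Lc (fine Lc M) (n + 1))) × Fin (3 + 1) => lv v b.1) * Λ₁ v' - Λ₁ v' * Matrix.diagonal (fun b : ↥(pbox (towerTorus Lc (fine Lc M) (n + 1))) × Fin (3 + 1) => lv v b.1)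
            + (Matrix.diagonal (fun b : ↥(pbox (towerTorus Lc (fine Lc M) (n + 1))) × Fin (3 + 1) => lv v' b.1) * Λ₁ v - Λ₁ v * Matrix.diagonal (fun b : ↥(pbox (towerTorus Lc (fine Lc M) (n + 1))) × Fin (3 + 1) => lv v' b.1)))) := by
  -- the first-slot version of (J-X₂) (symmetry + `hPG₂`)
  have hPG₂' : ∀ (lam : ↥(pbox (towerTorus Lc (fine Lc M) (n + 1))) → ℝ) (h : ↥(pbox (towerTorus Lc (fine Lc M) (n + 1))) × Fin (3 + 1) → ℝ),
      𝒲₂ (fun b : ↥(pbox (towerTorus Lc (fine Lc M) (n + 1))) × Fin (3 + 1) =>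
            ∑ s : ↥(pbox (towerTorus Lc (fine Lc M) (n + 1))), tgrad (towerTorus Lc (fine Lc M) (n + 1)) (b.1, Sum.inl b.2) s * lam s) h
        = (1 / 2 : ℝ) • (𝒲₁ h * Matrix.diagonal (fun b : ↥(pbox (towerTorus Lc (fine Lc M) (n + 1))) × Fin (3 + 1) => lam b.1)
          - Matrix.diagonal (fun b : ↥(pbox (towerTorus Lc (fine Lc M) (n + 1))) × Fin (3 + 1) => lam b.1) * 𝒲₁ h) := fun lam h => by
    rw [hBcomm]; exact hPG₂ h lam
  -- the symmetrised second H-jet, solved for the second summand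
  have h2 : H₂f v' v = (H₂f v v' + H₂f v' v) - H₂f v v' := by abel
  have h2' : H₂f v v' + H₂f v' v = (2 : ℝ) • ((-2 * c) ^ 2 • 𝒲₂ (hv v) (hv v') + Λ₂ v v') := by
    rw [← hH₂' v v', smul_smul, show (2 : ℝ) * (1 / 2) = 1 by norm_num, one_smul]
  -- the diagonal gauge generators are symmetric and commute
  have hXt : ∀ w : κ → ℝ, (-(c • Matrix.diagonal (fun b : ↥(pbox (towerTorus Lc (fine Lc M) (n + 1))) × Fin (3 + 1) => lv w b.1)))ᵀ
      = -(c • Matrix.diagonal (fun b : ↥(pbox (towerTorus Lc (fine Lc M) (n + 1))) × Fin (3 + 1) => lv w b.1)) := fun w => by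
    rw [Matrix.transpose_neg, Matrix.transpose_smul, Matrix.diagonal_transpose]
  have hXX : -(c • Matrix.diagonal (fun b : ↥(pbox (towerTorus Lc (fine Lc M) (n + 1))) × Fin (3 + 1) => lv v' b.1)) * -(c • Matrix.diagonal (fun b : ↥(pbox (towerTorus Lc (fine Lc M) (n + 1))) × Fin (3 + 1) => lv v b.1))
      = -(c • Matrix.diagonal (fun b : ↥(pbox (towerTorus Lc (fine Lc M) (n + 1))) × Fin (3 + 1) => lv v b.1)) * -(c • Matrix.diagonal (fun b : ↥(pbox (towerTorus Lc (fine Lc M) (n + 1))) × Fin (3 + 1) => lv v' b.1)) := by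
    rw [neg_mul_neg, neg_mul_neg, Matrix.smul_mul, Matrix.smul_mul, Matrix.mul_smul, Matrix.mul_smul, Matrix.diagonal_mul_diagonal,
      Matrix.diagonal_mul_diagonal]
    exact congrArg (fun D => c • (c • D)) (congrArg Matrix.diagonal (funext fun b => mul_comm _ _))
  have hPt : (-(c • Matrix.diagonal (fun b : ↥(pbox (towerTorus Lc (fine Lc M) (n + 1))) × Fin (3 + 1) => lv v b.1)) * -(c • Matrix.diagonal (fun b : ↥(pbox (towerTorus Lc (fine Lc M) (n + 1))) × Fin (3 + 1) => lv v' b.1)))ᵀ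
      = -(c • Matrix.diagonal (fun b : ↥(pbox (towerTorus Lc (fine Lc M) (n + 1))) × Fin (3 + 1) => lv v' b.1)) * -(c • Matrix.diagonal (fun b : ↥(pbox (towerTorus Lc (fine Lc M) (n + 1))) × Fin (3 + 1) => lv v b.1)) := by
    rw [Matrix.transpose_mul, hXt, hXt]
  have hPt' : (-(c • Matrix.diagonal (fun b : ↥(pbox (towerTorus Lc (fine Lc M) (n + 1))) × Fin (3 + 1) => lv v' b.1)) * -(c • Matrix.diagonal (fun b : ↥(pbox (towerTorus Lc (fine Lc M) (n + 1))) × Fin (3 + 1) => lv v b.1)))ᵀ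
      = -(c • Matrix.diagonal (fun b : ↥(pbox (towerTorus Lc (fine Lc M) (n + 1))) × Fin (3 + 1) => lv v' b.1)) * -(c • Matrix.diagonal (fun b : ↥(pbox (towerTorus Lc (fine Lc M) (n + 1))) × Fin (3 + 1) => lv v b.1)) := by
    rw [Matrix.transpose_mul, hXt, hXt, hXX]
  rw [hH'₂f, hH'₂f, hPt, hPt', hXt, hXt,
    show H₀ * (-(c • Matrix.diagonal (fun b : ↥(pbox (towerTorus Lc (fine Lc M) (n + 1))) × Fin (3 + 1) => lv v' b.1)) * -(c • Matrix.diagonal (fun b : ↥(pbox (towerTorus Lc (fine Lc M) (n + 1))) × Fin (3 + 1) => lv v b.1)))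
      = H₀ * (-(c • Matrix.diagonal (fun b : ↥(pbox (towerTorus Lc (fine Lc M) (n + 1))) × Fin (3 + 1) => lv v b.1)) * -(c • Matrix.diagonal (fun b : ↥(pbox (towerTorus Lc (fine Lc M) (n + 1))) × Fin (3 + 1) => lv v' b.1))) by rw [hXX],
    h2, h2', hH₁', hH₁', hBaddl, hBaddr, hBaddr, hPG₂ (hv v) (lv v'), hPG₂' (lv v) (hv v'), hPG₂ _ (lv v'), hPG₁ (lv v)]
  -- name the atoms, then normalise (pure module algebra over `ℝ`)
  generalize Matrix.diagonal (fun b : ↥(pbox (towerTorus Lc (fine Lc M) (n + 1))) × Fin (3 + 1) => lv v b.1) = E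
  generalize Matrix.diagonal (fun b : ↥(pbox (towerTorus Lc (fine Lc M) (n + 1))) × Fin (3 + 1) => lv v' b.1) = E'
  generalize 𝒲₁ (hv v) = W
  generalize 𝒲₁ (hv v') = W'
  generalize 𝒲₂ (hv v) (hv v') = B
  generalize Λ₁ v = L
  generalize Λ₁ v' = L'
  generalize Λ₂ v v' = K
  generalize H₂f v v' = A
  simp only [Matrix.mul_sub, Matrix.sub_mul, Matrix.mul_add, Matrix.add_mul, Matrix.smul_mul, Matrix.mul_smul, Matrix.mul_neg, Matrix.neg_mul,
    smul_add, smul_sub, smul_neg, neg_neg, smul_smul, Matrix.mul_assoc]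
  module

end Gauge

/-! ## §2 The Wilson instantiation: a displayed symmetric torus bi-table with its pure-gauge row; (J-X) discharged at the wrapper's form pin -/

section Wilson

variable {κ : Type*}
  (hv : (κ → ℝ) → (↥(pbox (towerTorus Lc (fine Lc M) (n + 1))) × Fin (3 + 1) → ℝ))
  (lv : (κ → ℝ) → (↥(pbox (towerTorus Lc (fine Lc M) (n + 1))) → ℝ))
  -- the wrapper's form pin at the finest storey (`hH₀ n B`, level `n+1−(n+1) = 0`)
  {H₀ : Matrix (↥(pbox (towerTorus Lc (fine Lc M) (n + 1))) × Fin (3 + 1)) (↥(pbox (towerTorus Lc (fine Lc M) (n + 1))) × Fin (3 + 1)) ℝ}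
  (hH₀ : H₀ = (perF (towerTorus Lc (fine Lc M) (n + 1)) (bhKStepSh 3 Lc (Dsh Lc) 0)).submatrix
      (fun b : ↥(pbox (towerTorus Lc (fine Lc M) (n + 1))) × Fin (3 + 1) => ((b.1, Sum.inl b.2) : Idx (towerTorus Lc (fine Lc M) (n + 1)) (Fib 3)))
      (fun b : ↥(pbox (towerTorus Lc (fine Lc M) (n + 1))) × Fin (3 + 1) => ((b.1, Sum.inl b.2) : Idx (towerTorus Lc (fine Lc M) (n + 1)) (Fib 3))))
  -- THE DISPLAYED TORUS BI-TABLE `T̂₂` (symmetric: `hTs`) with its ORDER-2 PURE-GAUGE ROW (J-X₂) `hX₂` against `hH₁f`'s cubic Wilson table `Ŵ_b := perF T (dper T (wilsonA 3 b))|ff`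
  (T₂ : ↥(pbox (towerTorus Lc (fine Lc M) (n + 1))) × Fin (3 + 1) → ↥(pbox (towerTorus Lc (fine Lc M) (n + 1))) × Fin (3 + 1) → Matrix (↥(pbox (towerTorus Lc (fine Lc M) (n + 1))) × Fin (3 + 1)) (↥(pbox (towerTorus Lc (fine Lc M) (n + 1))) × Fin (3 + 1)) ℝ)
  (hTs : ∀ b b' : ↥(pbox (towerTorus Lc (fine Lc M) (n + 1))) × Fin (3 + 1), T₂ b b' = T₂ b' b)
  (hX₂ : ∀ (b : ↥(pbox (towerTorus Lc (fine Lc M) (n + 1))) × Fin (3 + 1)) (lam : ↥(pbox (towerTorus Lc (fine Lc M) (n + 1))) → ℝ),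
    ∑ b' : ↥(pbox (towerTorus Lc (fine Lc M) (n + 1))) × Fin (3 + 1), (∑ s : ↥(pbox (towerTorus Lc (fine Lc M) (n + 1))), tgrad (towerTorus Lc (fine Lc M) (n + 1)) (b'.1, Sum.inl b'.2) s * lam s) • T₂ b b'
      = (1 / 2 : ℝ) • ((perF (towerTorus Lc (fine Lc M) (n + 1)) (dper (towerTorus Lc (fine Lc M) (n + 1)) (wilsonA 3 b.2 (b.1 : Site (3 + 1))))).submatrix
            (fun b : ↥(pbox (towerTorus Lc (fine Lc M) (n + 1))) × Fin (3 + 1) => ((b.1, Sum.inl b.2) : Idx (towerTorus Lc (fine Lc M) (n + 1)) (Fib 3)))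
            (fun b : ↥(pbox (towerTorus Lc (fine Lc M) (n + 1))) × Fin (3 + 1) => ((b.1, Sum.inl b.2) : Idx (towerTorus Lc (fine Lc M) (n + 1)) (Fib 3))) * Matrix.diagonal (fun b : ↥(pbox (towerTorus Lc (fine Lc M) (n + 1))) × Fin (3 + 1) => lam b.1)
        - Matrix.diagonal (fun b : ↥(pbox (towerTorus Lc (fine Lc M) (n + 1))) × Fin (3 + 1) => lam b.1) * (perF (towerTorus Lc (fine Lc M) (n + 1)) (dper (towerTorus Lc (fine Lc M) (n + 1)) (wilsonA 3 b.2 (b.1 : Site (3 + 1))))).submatrix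
            (fun b : ↥(pbox (towerTorus Lc (fine Lc M) (n + 1))) × Fin (3 + 1) => ((b.1, Sum.inl b.2) : Idx (towerTorus Lc (fine Lc M) (n + 1)) (Fib 3)))
            (fun b : ↥(pbox (towerTorus Lc (fine Lc M) (n + 1))) × Fin (3 + 1) => ((b.1, Sum.inl b.2) : Idx (towerTorus Lc (fine Lc M) (n + 1)) (Fib 3)))))
  -- v5's first H-jet in `hH₁f`'s shape at the top storey (`hb (n+1) = hv` by `hbtop`): Wilson sector + the rest `Λ₁` (Λ-words, lower storeys)
  (Λ₁ : (κ → ℝ) → Matrix (↥(pbox (towerTorus Lc (fine Lc M) (n + 1))) × Fin (3 + 1)) (↥(pbox (towerTorus Lc (fine Lc M) (n + 1))) × Fin (3 + 1)) ℝ)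
  (H₁f : (κ → ℝ) → Matrix (↥(pbox (towerTorus Lc (fine Lc M) (n + 1))) × Fin (3 + 1)) (↥(pbox (towerTorus Lc (fine Lc M) (n + 1))) × Fin (3 + 1)) ℝ)
  (hH₁ : ∀ v, H₁f v = (-2 * c) • ∑ b : ↥(pbox (towerTorus Lc (fine Lc M) (n + 1))) × Fin (3 + 1), hv v b •
        (perF (towerTorus Lc (fine Lc M) (n + 1)) (dper (towerTorus Lc (fine Lc M) (n + 1)) (wilsonA 3 b.2 (b.1 : Site (3 + 1))))).submatrix
            (fun b : ↥(pbox (towerTorus Lc (fine Lc M) (n + 1))) × Fin (3 + 1) => ((b.1, Sum.inl b.2) : Idx (towerTorus Lc (fine Lc M) (n + 1)) (Fib 3)))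
            (fun b : ↥(pbox (towerTorus Lc (fine Lc M) (n + 1))) × Fin (3 + 1) => ((b.1, Sum.inl b.2) : Idx (towerTorus Lc (fine Lc M) (n + 1)) (Fib 3)))
      + Λ₁ v)
  -- the NAME `Λ₂` of the remainder of the symmetrised second H-jet off its `(−2c)²`-weighted Wilson bi-sector over `T̂₂`
  (Λ₂ : (κ → ℝ) → (κ → ℝ) → Matrix (↥(pbox (towerTorus Lc (fine Lc M) (n + 1))) × Fin (3 + 1)) (↥(pbox (towerTorus Lc (fine Lc M) (n + 1))) × Fin (3 + 1)) ℝ)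
  (H₂f : (κ → ℝ) → (κ → ℝ) → Matrix (↥(pbox (towerTorus Lc (fine Lc M) (n + 1))) × Fin (3 + 1)) (↥(pbox (towerTorus Lc (fine Lc M) (n + 1))) × Fin (3 + 1)) ℝ)
  (hH₂ : ∀ v v', (1 / 2 : ℝ) • (H₂f v v' + H₂f v' v)
    = (-2 * c) ^ 2 • ∑ b : ↥(pbox (towerTorus Lc (fine Lc M) (n + 1))) × Fin (3 + 1), ∑ b' : ↥(pbox (towerTorus Lc (fine Lc M) (n + 1))) × Fin (3 + 1), (hv v b * hv v' b') • T₂ b b' + Λ₂ v v')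
  (H'₂f : (κ → ℝ) → (κ → ℝ) → Matrix (↥(pbox (towerTorus Lc (fine Lc M) (n + 1))) × Fin (3 + 1)) (↥(pbox (towerTorus Lc (fine Lc M) (n + 1))) × Fin (3 + 1)) ℝ)
  (hH'₂f : ∀ v v', H'₂f v v' = ((-(c • Matrix.diagonal (fun b : (↥(pbox (towerTorus Lc (fine Lc M) (n + 1))) × Fin (3 + 1)) => lv v b.1))) * (-(c • Matrix.diagonal (fun b : (↥(pbox (towerTorus Lc (fine Lc M) (n + 1))) × Fin (3 + 1)) => lv v' b.1))))ᵀ * H₀ + (-((-(c • Matrix.diagonal (fun b : (↥(pbox (towerTorus Lc (fine Lc M) (n + 1))) × Fin (3 + 1)) => lv v b.1)))ᵀ * H₁f v') + -((-(c • Matrix.diagonal (fun b : (↥(pbox (towerTorus Lc (fine Lc M) (n + 1))) × Fin (3 + 1)) => lv v b.1)))ᵀ * H₀ * (-(c • Matrix.diagonal (fun b : (↥(pbox (towerTorus Lc (fine Lc M) (n + 1))) × Fin (3 + 1)) => lv v' b.1)))))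
    + ((-((-(c • Matrix.diagonal (fun b : (↥(pbox (towerTorus Lc (fine Lc M) (n + 1))) × Fin (3 + 1)) => lv v b.1)))ᵀ * H₁f v') + -((-(c • Matrix.diagonal (fun b : (↥(pbox (towerTorus Lc (fine Lc M) (n + 1))) × Fin (3 + 1)) => lv v b.1)))ᵀ * H₀ * (-(c • Matrix.diagonal (fun b : (↥(pbox (towerTorus Lc (fine Lc M) (n + 1))) × Fin (3 + 1)) => lv v' b.1))))) + (H₂f v v' + H₁f v * (-(c • Matrix.diagonal (fun b : (↥(pbox (towerTorus Lc (fine Lc M) (n + 1))) × Fin (3 + 1)) => lv v' b.1))) + (H₁f v * (-(c • Matrix.diagonal (fun b : (↥(pbox (towerTorus Lc (fine Lc M) (n + 1))) × Fin (3 + 1)) => lv v' b.1))) + H₀ * ((-(c • Matrix.diagonal (fun b : (↥(pbox (towerTorus Lc (fine Lc M) (n + 1))) × Fin (3 + 1)) => lv v b.1))) * (-(c • Matrix.diagonal (fun b : (↥(pbox (towerTorus Lc (fine Lc M) (n + 1))) × Fin (3 + 1)) => lv v' b.1))))))))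

omit [NeZero Lc] [∀ μ, NeZero (M μ)] in
/-- [folklore] the double-sum bi-table form is additive in the first weight. -/
theorem biTable_add_left (h₁ h₂ h' : ↥(pbox (towerTorus Lc (fine Lc M) (n + 1))) × Fin (3 + 1) → ℝ) :
    ∑ b : ↥(pbox (towerTorus Lc (fine Lc M) (n + 1))) × Fin (3 + 1), ∑ b' : ↥(pbox (towerTorus Lc (fine Lc M) (n + 1))) × Fin (3 + 1), ((h₁ + h₂) b * h' b') • T₂ b b'
      = ∑ b : ↥(pbox (towerTorus Lc (fine Lc M) (n + 1))) × Fin (3 + 1), ∑ b' : ↥(pbox (towerTorus Lc (fine Lc M) (n + 1))) × Fin (3 + 1), (h₁ b * h' b') • T₂ b b'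
        + ∑ b : ↥(pbox (towerTorus Lc (fine Lc M) (n + 1))) × Fin (3 + 1), ∑ b' : ↥(pbox (towerTorus Lc (fine Lc M) (n + 1))) × Fin (3 + 1), (h₂ b * h' b') • T₂ b b' := by
  rw [← Finset.sum_add_distrib]
  refine Finset.sum_congr rfl fun b _ => ?_
  rw [← Finset.sum_add_distrib]
  exact Finset.sum_congr rfl fun b' _ => by rw [Pi.add_apply, add_mul, add_smul]

omit [NeZero Lc] [∀ μ, NeZero (M μ)] in
/-- [folklore] the double-sum bi-table form is additive in the second weight. -/
theorem biTable_add_right (h h₁ h₂ : ↥(pbox (towerTorus Lc (fine Lc M) (n + 1))) × Fin (3 + 1) → ℝ) :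
    ∑ b : ↥(pbox (towerTorus Lc (fine Lc M) (n + 1))) × Fin (3 + 1), ∑ b' : ↥(pbox (towerTorus Lc (fine Lc M) (n + 1))) × Fin (3 + 1), (h b * (h₁ + h₂) b') • T₂ b b'
      = ∑ b : ↥(pbox (towerTorus Lc (fine Lc M) (n + 1))) × Fin (3 + 1), ∑ b' : ↥(pbox (towerTorus Lc (fine Lc M) (n + 1))) × Fin (3 + 1), (h b * h₁ b') • T₂ b b'
        + ∑ b : ↥(pbox (towerTorus Lc (fine Lc M) (n + 1))) × Fin (3 + 1), ∑ b' : ↥(pbox (towerTorus Lc (fine Lc M) (n + 1))) × Fin (3 + 1), (h b * h₂ b') • T₂ b b' := by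
  rw [← Finset.sum_add_distrib]
  refine Finset.sum_congr rfl fun b _ => ?_
  rw [← Finset.sum_add_distrib]
  exact Finset.sum_congr rfl fun b' _ => by rw [Pi.add_apply, mul_add, add_smul]

omit [NeZero Lc] [∀ μ, NeZero (M μ)] in
include hTs in
/-- [folklore] the double-sum bi-table form over a SYMMETRIC table is symmetric in the two weights. -/
theorem biTable_comm (h h' : ↥(pbox (towerTorus Lc (fine Lc M) (n + 1))) × Fin (3 + 1) → ℝ) :
    ∑ b : ↥(pbox (towerTorus Lc (fine Lc M) (n + 1))) × Fin (3 + 1), ∑ b' : ↥(pbox (towerTorus Lc (fine Lc M) (n + 1))) × Fin (3 + 1), (h b * h' b') • T₂ b b'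
      = ∑ b : ↥(pbox (towerTorus Lc (fine Lc M) (n + 1))) × Fin (3 + 1), ∑ b' : ↥(pbox (towerTorus Lc (fine Lc M) (n + 1))) × Fin (3 + 1), (h' b * h b') • T₂ b b' := by
  rw [Finset.sum_comm]
  exact Finset.sum_congr rfl fun b _ => Finset.sum_congr rfl fun b' _ => by rw [hTs b' b, mul_comm]

omit [NeZero Lc] [∀ μ, NeZero (M μ)] in
/-- [folklore] homogeneity of the double-sum bi-table form in the two weights at once: `𝒲₂ (r•x) (r•y) = (r·r) • 𝒲₂ x y`. -/
theorem biTable_smul_smul (r : ℝ) (x y : ↥(pbox (towerTorus Lc (fine Lc M) (n + 1))) × Fin (3 + 1) → ℝ) :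
    ∑ b : ↥(pbox (towerTorus Lc (fine Lc M) (n + 1))) × Fin (3 + 1), ∑ b' : ↥(pbox (towerTorus Lc (fine Lc M) (n + 1))) × Fin (3 + 1), ((r • x) b * (r • y) b') • T₂ b b'
      = (r * r) • ∑ b : ↥(pbox (towerTorus Lc (fine Lc M) (n + 1))) × Fin (3 + 1), ∑ b' : ↥(pbox (towerTorus Lc (fine Lc M) (n + 1))) × Fin (3 + 1), (x b * y b') • T₂ b b' := by
  rw [Finset.smul_sum]
  refine Finset.sum_congr rfl fun b _ => ?_
  rw [Finset.smul_sum]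
  refine Finset.sum_congr rfl fun b' _ => ?_
  rw [smul_smul, Pi.smul_apply, Pi.smul_apply, smul_eq_mul, smul_eq_mul]
  exact congrArg (· • T₂ b b') (by ring)

omit [NeZero Lc] [∀ μ, NeZero (M μ)] in
include hX₂ in
/-- [folklore] **(J-X₂) for the bi-table form**: `Σ_b Σ_{b′} (h_b·(Dλ)_{b′}) • T̂₂ b b′ = ½•((Σ_b h_b • Ŵ_b) E_λ − E_λ (Σ_b h_b • Ŵ_b))` (`hX₂` summed along `h`). -/
theorem biTable_pureGauge_snd (h : ↥(pbox (towerTorus Lc (fine Lc M) (n + 1))) × Fin (3 + 1) → ℝ) (lam : ↥(pbox (towerTorus Lc (fine Lc M) (n + 1))) → ℝ) :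
    ∑ b : ↥(pbox (towerTorus Lc (fine Lc M) (n + 1))) × Fin (3 + 1), ∑ b' : ↥(pbox (towerTorus Lc (fine Lc M) (n + 1))) × Fin (3 + 1), (h b * (fun b : ↥(pbox (towerTorus Lc (fine Lc M) (n + 1))) × Fin (3 + 1) =>
            ∑ s : ↥(pbox (towerTorus Lc (fine Lc M) (n + 1))), tgrad (towerTorus Lc (fine Lc M) (n + 1)) (b.1, Sum.inl b.2) s * lam s) b') • T₂ b b'
      = (1 / 2 : ℝ) • ((∑ b : ↥(pbox (towerTorus Lc (fine Lc M) (n + 1))) × Fin (3 + 1), h b •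
            (perF (towerTorus Lc (fine Lc M) (n + 1)) (dper (towerTorus Lc (fine Lc M) (n + 1)) (wilsonA 3 b.2 (b.1 : Site (3 + 1))))).submatrix
            (fun b : ↥(pbox (towerTorus Lc (fine Lc M) (n + 1))) × Fin (3 + 1) => ((b.1, Sum.inl b.2) : Idx (towerTorus Lc (fine Lc M) (n + 1)) (Fib 3)))
            (fun b : ↥(pbox (towerTorus Lc (fine Lc M) (n + 1))) × Fin (3 + 1) => ((b.1, Sum.inl b.2) : Idx (towerTorus Lc (fine Lc M) (n + 1)) (Fib 3)))) * Matrix.diagonal (fun b : ↥(pbox (towerTorus Lc (fine Lc M) (n + 1))) × Fin (3 + 1) => lam b.1)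
          - Matrix.diagonal (fun b : ↥(pbox (towerTorus Lc (fine Lc M) (n + 1))) × Fin (3 + 1) => lam b.1) * ∑ b : ↥(pbox (towerTorus Lc (fine Lc M) (n + 1))) × Fin (3 + 1), h b •
            (perF (towerTorus Lc (fine Lc M) (n + 1)) (dper (towerTorus Lc (fine Lc M) (n + 1)) (wilsonA 3 b.2 (b.1 : Site (3 + 1))))).submatrix
            (fun b : ↥(pbox (towerTorus Lc (fine Lc M) (n + 1))) × Fin (3 + 1) => ((b.1, Sum.inl b.2) : Idx (towerTorus Lc (fine Lc M) (n + 1)) (Fib 3)))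
            (fun b : ↥(pbox (towerTorus Lc (fine Lc M) (n + 1))) × Fin (3 + 1) => ((b.1, Sum.inl b.2) : Idx (towerTorus Lc (fine Lc M) (n + 1)) (Fib 3)))) := by
  rw [Finset.sum_mul, Finset.mul_sum, ← Finset.sum_sub_distrib, Finset.smul_sum]
  refine Finset.sum_congr rfl fun b _ => ?_
  rw [Matrix.smul_mul, Matrix.mul_smul, ← smul_sub, smul_comm, ← hX₂ b lam, Finset.smul_sum]
  exact Finset.sum_congr rfl fun b' _ => by rw [smul_smul]

include hH₀ hTs hX₂ hH₁ hH₂ hH'₂f in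
/-- [folklore] **`Hprime2_symm_eq_biW_along_sums` — THE WILSON INSTANTIATION**: for `hH₁f`'s cubic Wilson table `Ŵ_b`, a DISPLAYED symmetric torus bi-table `T̂₂` obeying the
order-2 pure-gauge row (J-X₂) `hX₂`, and the wrapper's form pin `hH₀` ((J-X) DISCHARGED: leaf-02 `perF_bhKStepSh_Dsh_ff_eq_perF_bhKStepAt` + g39 `torus_form_pureGauge_fun_of_box`),
v5's conjugated second H-jet, SYMMETRISED, is `(−2c)² •` the bi-table form along the two GAUGE-COMPLETED directions `hv v + tgrad·lv v`, `hv v′ + tgrad·lv v′`, PLUS the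
displayed remainder `Λ₂ v v′ + c•([E_{lv v}, Λ₁ v′] + [E_{lv v′}, Λ₁ v])` (§1 at `𝒲₁ h := Σ_b h_b • Ŵ_b`, `𝒲₂ h h′ := Σ_b Σ_{b′} (h_b·h′_{b′}) • T̂₂ b b′`). -/
theorem Hprime2_symm_eq_biW_along_sums (v v' : κ → ℝ) :
    (1 / 2 : ℝ) • (H'₂f v v' + H'₂f v' v)
      = (-2 * c) ^ 2 • ∑ b : ↥(pbox (towerTorus Lc (fine Lc M) (n + 1))) × Fin (3 + 1), ∑ b' : ↥(pbox (towerTorus Lc (fine Lc M) (n + 1))) × Fin (3 + 1),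
            ((hv v + (fun b : ↥(pbox (towerTorus Lc (fine Lc M) (n + 1))) × Fin (3 + 1) =>
            ∑ s : ↥(pbox (towerTorus Lc (fine Lc M) (n + 1))), tgrad (towerTorus Lc (fine Lc M) (n + 1)) (b.1, Sum.inl b.2) s * lv v s)) b
              * (hv v' + (fun b : ↥(pbox (towerTorus Lc (fine Lc M) (n + 1))) × Fin (3 + 1) =>
            ∑ s : ↥(pbox (towerTorus Lc (fine Lc M) (n + 1))), tgrad (towerTorus Lc (fine Lc M) (n + 1)) (b.1, Sum.inl b.2) s * lv v' s)) b') • T₂ b b'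
        + (Λ₂ v v' + c • (Matrix.diagonal (fun b : ↥(pbox (towerTorus Lc (fine Lc M) (n + 1))) × Fin (3 + 1) => lv v b.1) * Λ₁ v' - Λ₁ v' * Matrix.diagonal (fun b : ↥(pbox (towerTorus Lc (fine Lc M) (n + 1))) × Fin (3 + 1) => lv v b.1)
            + (Matrix.diagonal (fun b : ↥(pbox (towerTorus Lc (fine Lc M) (n + 1))) × Fin (3 + 1) => lv v' b.1) * Λ₁ v - Λ₁ v * Matrix.diagonal (fun b : ↥(pbox (towerTorus Lc (fine Lc M) (n + 1))) × Fin (3 + 1) => lv v' b.1)))) := by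
  have hH₀' : H₀ = (perF (towerTorus Lc (fine Lc M) (n + 1)) (bhKStepAt 3 (toSite (ctrOff (3 + 1) Lc)) Lc 0)).submatrix
      (fun b : ↥(pbox (towerTorus Lc (fine Lc M) (n + 1))) × Fin (3 + 1) => ((b.1, Sum.inl b.2) : Idx (towerTorus Lc (fine Lc M) (n + 1)) (Fib 3)))
      (fun b : ↥(pbox (towerTorus Lc (fine Lc M) (n + 1))) × Fin (3 + 1) => ((b.1, Sum.inl b.2) : Idx (towerTorus Lc (fine Lc M) (n + 1)) (Fib 3))) := by
    rw [hH₀]; exact perF_bhKStepSh_Dsh_ff_eq_perF_bhKStepAt (towerTorus Lc (fine Lc M) (n + 1)) 0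
  exact Hprime2_symm_eq_biW_along_sums_of_pureGauge M n c hv lv H₀
    (fun h => ∑ b : ↥(pbox (towerTorus Lc (fine Lc M) (n + 1))) × Fin (3 + 1), h b •
        (perF (towerTorus Lc (fine Lc M) (n + 1)) (dper (towerTorus Lc (fine Lc M) (n + 1)) (wilsonA 3 b.2 (b.1 : Site (3 + 1))))).submatrix
            (fun b : ↥(pbox (towerTorus Lc (fine Lc M) (n + 1))) × Fin (3 + 1) => ((b.1, Sum.inl b.2) : Idx (towerTorus Lc (fine Lc M) (n + 1)) (Fib 3)))
            (fun b : ↥(pbox (towerTorus Lc (fine Lc M) (n + 1))) × Fin (3 + 1) => ((b.1, Sum.inl b.2) : Idx (towerTorus Lc (fine Lc M) (n + 1)) (Fib 3))))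
    Λ₁ H₁f hH₁ (fun h h' => ∑ b : ↥(pbox (towerTorus Lc (fine Lc M) (n + 1))) × Fin (3 + 1), ∑ b' : ↥(pbox (towerTorus Lc (fine Lc M) (n + 1))) × Fin (3 + 1), (h b * h' b') • T₂ b b') Λ₂ H₂f hH₂ H'₂f hH'₂f
    (fun lam => torus_form_pureGauge_fun_of_box (towerTorus Lc (fine Lc M) (n + 1)) (toSite (ctrOff (3 + 1) Lc)) Lc lam hH₀')
    (fun h lam => biTable_pureGauge_snd M n T₂ hX₂ h lam) (fun h₁ h₂ h' => biTable_add_left M n T₂ h₁ h₂ h')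
    (fun h h₁ h₂ => biTable_add_right M n T₂ h h₁ h₂) (fun h h' => biTable_comm M n T₂ hTs h h') v v'

end Wilson

/-! ## §3 Along two pinned directions: the Wilson bi-sector along the two torus ℋ-columns, weighted by `cE²` -/

section Direction

variable {κ : Type*} [DecidableEq κ] (Pn : Pins) (yN : κ → Site (3 + 1)) (μN : κ → Fin (3 + 1))
  (hv : (κ → ℝ) → (↥(pbox (towerTorus Lc (fine Lc M) (n + 1))) × Fin (3 + 1) → ℝ))
  (hhvl : ∀ (r : ℝ) (x y : κ → ℝ), hv (r • x + y) = r • hv x + hv y)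
  (lv : (κ → ℝ) → (↥(pbox (towerTorus Lc (fine Lc M) (n + 1))) → ℝ))
  (hlv : ∀ (r : ℝ) (x y : κ → ℝ), lv (r • x + y) = r • lv x + lv y)
  -- (J-W″) at `r := 1` (g39 #5 at the pins, as `TowerHN1Row` ∕ #3 ∕ #6)
  (hJW : ∀ (a : κ) (b : ↥(pbox (towerTorus Lc (fine Lc M) (n + 1))) × Fin (3 + 1)), hv (Pi.single a 1) b
      = perF (towerTorus Lc (fine Lc M) (n + 1)) (AN (Roots.ctr Lc) (n + 1)) (b.1, Sum.inl b.2)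
          (wrapPt (towerTorus Lc (fine Lc M) (n + 1)) (((Lc ^ (n + 1 + 1) : ℕ) : ℤ) • yN a), Sum.inr (μN a))
        - ∑ s : ↥(pbox (towerTorus Lc (fine Lc M) (n + 1))), tgrad (towerTorus Lc (fine Lc M) (n + 1)) (b.1, Sum.inl b.2) s * lv (Pi.single a 1) s)
  {H₀ : Matrix (↥(pbox (towerTorus Lc (fine Lc M) (n + 1))) × Fin (3 + 1)) (↥(pbox (towerTorus Lc (fine Lc M) (n + 1))) × Fin (3 + 1)) ℝ}
  (hH₀ : H₀ = (perF (towerTorus Lc (fine Lc M) (n + 1)) (bhKStepSh 3 Lc (Dsh Lc) 0)).submatrix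
      (fun b : ↥(pbox (towerTorus Lc (fine Lc M) (n + 1))) × Fin (3 + 1) => ((b.1, Sum.inl b.2) : Idx (towerTorus Lc (fine Lc M) (n + 1)) (Fib 3)))
      (fun b : ↥(pbox (towerTorus Lc (fine Lc M) (n + 1))) × Fin (3 + 1) => ((b.1, Sum.inl b.2) : Idx (towerTorus Lc (fine Lc M) (n + 1)) (Fib 3))))
  (T₂ : ↥(pbox (towerTorus Lc (fine Lc M) (n + 1))) × Fin (3 + 1) → ↥(pbox (towerTorus Lc (fine Lc M) (n + 1))) × Fin (3 + 1) → Matrix (↥(pbox (towerTorus Lc (fine Lc M) (n + 1))) × Fin (3 + 1)) (↥(pbox (towerTorus Lc (fine Lc M) (n + 1))) × Fin (3 + 1)) ℝ)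
  (hTs : ∀ b b' : ↥(pbox (towerTorus Lc (fine Lc M) (n + 1))) × Fin (3 + 1), T₂ b b' = T₂ b' b)
  (hX₂ : ∀ (b : ↥(pbox (towerTorus Lc (fine Lc M) (n + 1))) × Fin (3 + 1)) (lam : ↥(pbox (towerTorus Lc (fine Lc M) (n + 1))) → ℝ),
    ∑ b' : ↥(pbox (towerTorus Lc (fine Lc M) (n + 1))) × Fin (3 + 1), (∑ s : ↥(pbox (towerTorus Lc (fine Lc M) (n + 1))), tgrad (towerTorus Lc (fine Lc M) (n + 1)) (b'.1, Sum.inl b'.2) s * lam s) • T₂ b b'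
      = (1 / 2 : ℝ) • ((perF (towerTorus Lc (fine Lc M) (n + 1)) (dper (towerTorus Lc (fine Lc M) (n + 1)) (wilsonA 3 b.2 (b.1 : Site (3 + 1))))).submatrix
            (fun b : ↥(pbox (towerTorus Lc (fine Lc M) (n + 1))) × Fin (3 + 1) => ((b.1, Sum.inl b.2) : Idx (towerTorus Lc (fine Lc M) (n + 1)) (Fib 3)))
            (fun b : ↥(pbox (towerTorus Lc (fine Lc M) (n + 1))) × Fin (3 + 1) => ((b.1, Sum.inl b.2) : Idx (towerTorus Lc (fine Lc M) (n + 1)) (Fib 3))) * Matrix.diagonal (fun b : ↥(pbox (towerTorus Lc (fine Lc M) (n + 1))) × Fin (3 + 1) => lam b.1)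
        - Matrix.diagonal (fun b : ↥(pbox (towerTorus Lc (fine Lc M) (n + 1))) × Fin (3 + 1) => lam b.1) * (perF (towerTorus Lc (fine Lc M) (n + 1)) (dper (towerTorus Lc (fine Lc M) (n + 1)) (wilsonA 3 b.2 (b.1 : Site (3 + 1))))).submatrix
            (fun b : ↥(pbox (towerTorus Lc (fine Lc M) (n + 1))) × Fin (3 + 1) => ((b.1, Sum.inl b.2) : Idx (towerTorus Lc (fine Lc M) (n + 1)) (Fib 3)))
            (fun b : ↥(pbox (towerTorus Lc (fine Lc M) (n + 1))) × Fin (3 + 1) => ((b.1, Sum.inl b.2) : Idx (towerTorus Lc (fine Lc M) (n + 1)) (Fib 3)))))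
  (Λ₁ : (κ → ℝ) → Matrix (↥(pbox (towerTorus Lc (fine Lc M) (n + 1))) × Fin (3 + 1)) (↥(pbox (towerTorus Lc (fine Lc M) (n + 1))) × Fin (3 + 1)) ℝ)
  (H₁f : (κ → ℝ) → Matrix (↥(pbox (towerTorus Lc (fine Lc M) (n + 1))) × Fin (3 + 1)) (↥(pbox (towerTorus Lc (fine Lc M) (n + 1))) × Fin (3 + 1)) ℝ)
  (hH₁ : ∀ v, H₁f v = (-2 * c) • ∑ b : ↥(pbox (towerTorus Lc (fine Lc M) (n + 1))) × Fin (3 + 1), hv v b •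
        (perF (towerTorus Lc (fine Lc M) (n + 1)) (dper (towerTorus Lc (fine Lc M) (n + 1)) (wilsonA 3 b.2 (b.1 : Site (3 + 1))))).submatrix
            (fun b : ↥(pbox (towerTorus Lc (fine Lc M) (n + 1))) × Fin (3 + 1) => ((b.1, Sum.inl b.2) : Idx (towerTorus Lc (fine Lc M) (n + 1)) (Fib 3)))
            (fun b : ↥(pbox (towerTorus Lc (fine Lc M) (n + 1))) × Fin (3 + 1) => ((b.1, Sum.inl b.2) : Idx (towerTorus Lc (fine Lc M) (n + 1)) (Fib 3)))
      + Λ₁ v)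
  (Λ₂ : (κ → ℝ) → (κ → ℝ) → Matrix (↥(pbox (towerTorus Lc (fine Lc M) (n + 1))) × Fin (3 + 1)) (↥(pbox (towerTorus Lc (fine Lc M) (n + 1))) × Fin (3 + 1)) ℝ)
  (H₂f : (κ → ℝ) → (κ → ℝ) → Matrix (↥(pbox (towerTorus Lc (fine Lc M) (n + 1))) × Fin (3 + 1)) (↥(pbox (towerTorus Lc (fine Lc M) (n + 1))) × Fin (3 + 1)) ℝ)
  (hH₂ : ∀ v v', (1 / 2 : ℝ) • (H₂f v v' + H₂f v' v)
    = (-2 * c) ^ 2 • ∑ b : ↥(pbox (towerTorus Lc (fine Lc M) (n + 1))) × Fin (3 + 1), ∑ b' : ↥(pbox (towerTorus Lc (fine Lc M) (n + 1))) × Fin (3 + 1), (hv v b * hv v' b') • T₂ b b' + Λ₂ v v')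
  (H'₂f : (κ → ℝ) → (κ → ℝ) → Matrix (↥(pbox (towerTorus Lc (fine Lc M) (n + 1))) × Fin (3 + 1)) (↥(pbox (towerTorus Lc (fine Lc M) (n + 1))) × Fin (3 + 1)) ℝ)
  (hH'₂f : ∀ v v', H'₂f v v' = ((-(c • Matrix.diagonal (fun b : (↥(pbox (towerTorus Lc (fine Lc M) (n + 1))) × Fin (3 + 1)) => lv v b.1))) * (-(c • Matrix.diagonal (fun b : (↥(pbox (towerTorus Lc (fine Lc M) (n + 1))) × Fin (3 + 1)) => lv v' b.1))))ᵀ * H₀ + (-((-(c • Matrix.diagonal (fun b : (↥(pbox (towerTorus Lc (fine Lc M) (n + 1))) × Fin (3 + 1)) => lv v b.1)))ᵀ * H₁f v') + -((-(c • Matrix.diagonal (fun b : (↥(pbox (towerTorus Lc (fine Lc M) (n + 1))) × Fin (3 + 1)) => lv v b.1)))ᵀ * H₀ * (-(c • Matrix.diagonal (fun b : (↥(pbox (towerTorus Lc (fine Lc M) (n + 1))) × Fin (3 + 1)) => lv v' b.1)))))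
    + ((-((-(c • Matrix.diagonal (fun b : (↥(pbox (towerTorus Lc (fine Lc M) (n + 1))) × Fin (3 + 1)) => lv v b.1)))ᵀ * H₁f v') + -((-(c • Matrix.diagonal (fun b : (↥(pbox (towerTorus Lc (fine Lc M) (n + 1))) × Fin (3 + 1)) => lv v b.1)))ᵀ * H₀ * (-(c • Matrix.diagonal (fun b : (↥(pbox (towerTorus Lc (fine Lc M) (n + 1))) × Fin (3 + 1)) => lv v' b.1))))) + (H₂f v v' + H₁f v * (-(c • Matrix.diagonal (fun b : (↥(pbox (towerTorus Lc (fine Lc M) (n + 1))) × Fin (3 + 1)) => lv v' b.1))) + (H₁f v * (-(c • Matrix.diagonal (fun b : (↥(pbox (towerTorus Lc (fine Lc M) (n + 1))) × Fin (3 + 1)) => lv v' b.1))) + H₀ * ((-(c • Matrix.diagonal (fun b : (↥(pbox (towerTorus Lc (fine Lc M) (n + 1))) × Fin (3 + 1)) => lv v b.1))) * (-(c • Matrix.diagonal (fun b : (↥(pbox (towerTorus Lc (fine Lc M) (n + 1))) × Fin (3 + 1)) => lv v' b.1))))))))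
  -- the pinned directions `dv = r•e_a`, `dv′ = r•e_{a′}` and the pin `(−2c)·r = cE (n+2)` of their scale
  (r : ℝ) (hr : (-2 * c) * r = Pn.cE (n + 1 + 1)) (a a' : κ)

include hhvl hlv hJW hH₀ hTs hX₂ hH₁ hH₂ hH'₂f hr in
/-- [folklore] **`Hprime2_symm_eq_sq_smul_bivertex_cols_add_rem` — ALONG TWO PINNED DIRECTIONS**: v5's conjugated second H-jet at `(r•e_a, r•e_{a′})`, SYMMETRISED, is
`(Pn.cE (n+2))² •` the bi-table form along the two torus ℋ-columns `colN̂_a`, `colN̂_{a′}` of the sources PLUS the displayed remainder `R₂(r•e_a, r•e_{a′})` (§2 + #3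
`direction_add_exact_eq_smul_col` twice: `hv (r•e_a) + tgrad·lv (r•e_a) = r • colN̂_a`; homogeneity `biTable_smul_smul`; `((−2c)·r)² = cE²` by `hr`) — the Wilson sector of
`hHN₂`'s LEFT side at the label pair, in the shape the row's PART 23 reads the RIGHT side's bi-vertex sector (`cE₂ ·` the symmetrised bi-vertex over `Ŵ₂ᵉ`). -/
theorem Hprime2_symm_eq_sq_smul_bivertex_cols_add_rem :
    (1 / 2 : ℝ) • (H'₂f (r • (Pi.single a (1 : ℝ) : κ → ℝ)) (r • (Pi.single a' (1 : ℝ) : κ → ℝ))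
        + H'₂f (r • (Pi.single a' (1 : ℝ) : κ → ℝ)) (r • (Pi.single a (1 : ℝ) : κ → ℝ)))
      = (Pn.cE (n + 1 + 1)) ^ 2 • ∑ b : ↥(pbox (towerTorus Lc (fine Lc M) (n + 1))) × Fin (3 + 1), ∑ b' : ↥(pbox (towerTorus Lc (fine Lc M) (n + 1))) × Fin (3 + 1),
            (perF (towerTorus Lc (fine Lc M) (n + 1)) (AN (Roots.ctr Lc) (n + 1)) (b.1, Sum.inl b.2)
              (wrapPt (towerTorus Lc (fine Lc M) (n + 1)) (((Lc ^ (n + 1 + 1) : ℕ) : ℤ) • yN a), Sum.inr (μN a))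
              * perF (towerTorus Lc (fine Lc M) (n + 1)) (AN (Roots.ctr Lc) (n + 1)) (b'.1, Sum.inl b'.2)
              (wrapPt (towerTorus Lc (fine Lc M) (n + 1)) (((Lc ^ (n + 1 + 1) : ℕ) : ℤ) • yN a'), Sum.inr (μN a'))) • T₂ b b'
        + (Λ₂ (r • (Pi.single a (1 : ℝ) : κ → ℝ)) (r • (Pi.single a' (1 : ℝ) : κ → ℝ)) + c • (Matrix.diagonal (fun b : ↥(pbox (towerTorus Lc (fine Lc M) (n + 1))) × Fin (3 + 1) => lv (r • (Pi.single a (1 : ℝ) : κ → ℝ)) b.1) * Λ₁ (r • (Pi.single a' (1 : ℝ) : κ → ℝ)) - Λ₁ (r • (Pi.single a' (1 : ℝ) : κ → ℝ)) * Matrix.diagonal (fun b : ↥(pbox (towerTorus Lc (fine Lc M) (n + 1))) × Fin (3 + 1) => lv (r • (Pi.single a (1 : ℝ) : κ → ℝ)) b.1)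
            + (Matrix.diagonal (fun b : ↥(pbox (towerTorus Lc (fine Lc M) (n + 1))) × Fin (3 + 1) => lv (r • (Pi.single a' (1 : ℝ) : κ → ℝ)) b.1) * Λ₁ (r • (Pi.single a (1 : ℝ) : κ → ℝ)) - Λ₁ (r • (Pi.single a (1 : ℝ) : κ → ℝ)) * Matrix.diagonal (fun b : ↥(pbox (towerTorus Lc (fine Lc M) (n + 1))) × Fin (3 + 1) => lv (r • (Pi.single a' (1 : ℝ) : κ → ℝ)) b.1)))) := by
  rw [Hprime2_symm_eq_biW_along_sums M n c hv lv hH₀ T₂ hTs hX₂ Λ₁ H₁f hH₁ Λ₂ H₂f hH₂ H'₂f hH'₂f,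
    direction_add_exact_eq_smul_col M n yN μN hv hhvl lv hlv hJW r a, direction_add_exact_eq_smul_col M n yN μN hv hhvl lv hlv hJW r a',
    biTable_smul_smul M n T₂, smul_smul, show (-2 * c) ^ 2 * (r * r) = (Pn.cE (n + 1 + 1)) ^ 2 by rw [← hr]; ring]

end Direction

end Summit.QuantumFields.BalabanUV.Beta.FP.TowerHN2RowJet

end
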